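import Summits.BirchSwinnertonDyer.BirchSwinnertonDyer.Theorems.GenusKolyvaginAtTwoGenusPrimitiveSupplyAtTwoTowerNormRelation

/-!
# Route `GenusKolyvaginAtTwo`, crux `GenusPrimitiveSupplyAtTwo` (stmt-BirchSwinnertonDyer-22136), line `genus-supply`:
# **`Y_M^{(n)} = A(n/m)·(Y_M^{(m)})′`** — the genus-character components along the tower, and the (R1)-chain input

Lead prover seat bsd-line-gk2-p1 (g3). Assembles `…TowerComponents` §3 (fibre decomposition of `Y_M^{(n)}` along
`res : 𝒢_n ↠ 𝒢_m`) with `…TowerNormRelation` (`Tr_{K[n]/K[m]} y(n) = A(n/m)·y(m)′`) and the value formula (`g_t·P′ = (t·P)′`):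
for `n = m·t` square-free of primes inert in `K` and prime to `N_E`, `M ⊆ {ℓ ∣ m}` (so that `χ_M` is defined at level `m`),
radicals `θ` (level `n`) and `θ′` (level `m`) of the same `ℓ*`, enumerations `G`, `Gm` of `𝒢_n`, `𝒢_m`:
  `Y_M^{(n)} = (∏_{ℓ ∣ t} a_ℓ) · (Y_M^{(m)})′` in `E(K[n])`, `A(t) = ∏_{ℓ∣t} a_ℓ`.
Consequence (the algebraic input of U-LEDGER (R1) at composite level): if every `a_ℓ`, `ℓ ∣ t`, is even (Kolyvagin primes at `2`)
and `Y_M^{(m)} ∈ 2^c E(K[m])`, then `Y_M^{(n)} ∈ 2^{c + #{ℓ∣t}} E(K[n])`; with `m = ∏M` (the conductor of `χ_M`) and `c = #M + 1` this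
is the hypothesis `Y_M^{(n)} ∈ 2^{r+1}E(K[n])` of the (R1)-mechanism `heegner_exists_two_zsmul_eq_derivedPoint_of_forall_genusComponents`
(`…GenusComponents`), now reduced to a statement about the genus Heegner point of `χ_M` AT ITS OWN LEVEL — the object whose
`2`-adic index the BSD-side ledger (♣) predicts. Helper (`--supports stmt-BirchSwinnertonDyer-22136`); BSD is not proved by any of this.
-/

set_option linter.dupNamespace false -- tree convention: `Summit.BirchSwinnertonDyer.BirchSwinnertonDyer.Theorems` (summit = sub-problem)

noncomputable section

open scoped Classical

namespace Summit.BirchSwinnertonDyer.BirchSwinnertonDyer.Theorems.GenusKoly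

open Finset NumberField WeierstrassCurve Literature.NumberTheory.EllipticCurves
  Literature.NumberTheory.EllipticCurves.ModularForms Summit.BirchSwinnertonDyer.Rank1Residual.X11b

section Heegner

variable {W : WeierstrassCurve ℚ} [NeZero (W.conductorNorm ℤ)] {K : Type} [Field K] [NumberField K]
  {Dt : ModularParametrizationData W (W.conductorNorm ℤ)} {β : ℤ} {ι : K →+* ℂ}

/-- **`Y_M^{(n)} = A(t)·(Y_M^{(m)})′` for `n = m·t`.** For `W` globally minimal, `K` imaginary quadratic with `d_K < −4` and the
Heegner hypothesis, `n` square-free with every prime factor inert in `K` and prime to `N_E`, a datum `d` of conductor `n`, a point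
`y ∈ E(K[m])` over `x(m)`, `M ⊆ {ℓ ∣ m}`... (any finite `M` with radicals at both levels), radicals `θ_ℓ ∈ K[n]`, `θ′_ℓ ∈ K[m]`
(`θ² = θ′² = ℓ*`), and enumerations `G ⊇ 𝒢_n`, `Gm ⊇ 𝒢_m`:
`Σ_{g∈G} χ_M(g) g·y(n) = (∏_{ℓ∣t} a_ℓ) · (Σ_{s∈Gm} χ_M(s) s·y)′`. [cite: GrossLMS1991, §3 (3.5), Prop. 3.7 (1), §4 (4.1)] -/
theorem heegner_genusComponent_eq_prod_frobeniusTrace_smul_map [W.IsElliptic] [W.IsGloballyMinimal]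
    (hK : IsImaginaryQuadratic K) (hD : NumberField.discr K < -4) (hH : SatisfiesHeegnerHypothesis (W.conductorNorm ℤ) K)
    {n : ℕ} (hn : Squarefree n) (hinert : ∀ q ∈ n.primeFactors, (Ideal.span {(q : 𝓞 K)}).IsPrime)
    (hN : ∀ q ∈ n.primeFactors, ¬ q ∣ W.conductorNorm ℤ) (d : KolyvaginHeegnerData Dt β ι n)
    {m t : ℕ} (hmt : m * t = n)
    {y : (W.baseChange (ringClassField K ι m)).toAffine.Point}
    (hy : WeierstrassCurve.Affine.Point.map (W' := W) (ringClassField K ι m).subtype.toRatAlgHom y =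
      heegnerPointComplexOfConductor Dt (NumberField.discr K) β m)
    (hle : ringClassField K ι m ≤ ringClassField K ι n)
    {θ : ℕ → ringClassField K ι n} {θ' : ℕ → ringClassField K ι m} {M : Finset ℕ}
    (hθ : ∀ ℓ ∈ M, θ ℓ ^ 2 = algebraMap ℚ (ringClassField K ι n) ((-1 : ℚ) ^ (ℓ / 2) * ℓ))
    (hθ' : ∀ ℓ ∈ M, θ' ℓ ^ 2 = algebraMap ℚ (ringClassField K ι m) ((-1 : ℚ) ^ (ℓ / 2) * ℓ))
    (G : Finset (ringClassField K ι n ≃ₐ[ℚ] ringClassField K ι n)) (hG : ∀ g, g ∈ G ↔ g ∈ ringClassGal ι n)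
    (Gm : Finset (ringClassField K ι m ≃ₐ[ℚ] ringClassField K ι m)) (hGm : ∀ s, s ∈ Gm ↔ s ∈ ringClassGal ι m) :
    ∑ g ∈ G, (∏ ℓ ∈ M, (if g (θ ℓ) = θ ℓ then (1 : ℤ) else -1)) • pointGalHom W (ringClassField K ι n) g d.y =
      (∏ ℓ ∈ t.primeFactors, W.frobeniusTrace ℓ) •
        WeierstrassCurve.Affine.Point.map (W' := W) (Subfield.inclusion hle).toRatAlgHom
          (∑ s ∈ Gm, (∏ ℓ ∈ M, (if s (θ' ℓ) = θ' ℓ then (1 : ℤ) else -1)) • pointGalHom W (ringClassField K ι m) s y) := by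
  have hn0 : n ≠ 0 := hn.ne_zero
  have hmn : m ∣ n := Dvd.intro t hmt
  obtain ⟨res, hres⟩ := RingClassTower.exists_restrictHom hK ι hmn hn0
  obtain ⟨lift, hliftS, hlift⟩ := heegner_exists_lift hK hmn hn0 hres Gm hGm
  rw [heegner_genusComponent_eq_sum_restrict hK hmn hn0 hres d hθ hθ' G hG Gm hGm lift hliftS hlift,
    heegner_sum_ringClassGalOver_eq_prod_frobeniusTrace_smul_map hK hD hH hn hinert hN d G hG t.primeFactors.card m t hmt rfl y
      hy hle,
    map_sum, Finset.smul_sum]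
  refine Finset.sum_congr rfl fun s hs ↦ ?_
  rw [map_zsmul, map_zsmul, smul_comm,
    pointGalHom_map_inclusion_eq_of_valueFormula (W := W) hle hres ⟨lift s, hliftS s hs⟩ y, hlift s hs]

/-- **The (R1)-chain input: components deep at their own level stay deep up the tower.** Same frame; if every `a_ℓ`, `ℓ ∣ t`, is
EVEN (e.g. all `ℓ ∣ t` Kolyvagin primes at `2`) and `Y_M^{(m)} ∈ 2^c E(K[m])`, then `Y_M^{(n)} ∈ 2^{c + #{ℓ ∣ t}} E(K[n])`. With
`m = ∏M` and `c = #M + 1` the conclusion is the hypothesis «`Y_M ∈ 2^{r+1}E(K[n])`» of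
`heegner_exists_two_zsmul_eq_derivedPoint_of_forall_genusComponents` for that `M`. [cite: GrossLMS1991, §3 (3.5), Prop. 3.7 (1)] -/
theorem heegner_exists_pow_smul_eq_genusComponent_of_level [W.IsElliptic] [W.IsGloballyMinimal]
    (hK : IsImaginaryQuadratic K) (hD : NumberField.discr K < -4) (hH : SatisfiesHeegnerHypothesis (W.conductorNorm ℤ) K)
    {n : ℕ} (hn : Squarefree n) (hinert : ∀ q ∈ n.primeFactors, (Ideal.span {(q : 𝓞 K)}).IsPrime)
    (hN : ∀ q ∈ n.primeFactors, ¬ q ∣ W.conductorNorm ℤ) (d : KolyvaginHeegnerData Dt β ι n)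
    {m t : ℕ} (hmt : m * t = n) (heven : ∀ ℓ ∈ t.primeFactors, (2 : ℤ) ∣ W.frobeniusTrace ℓ)
    {y : (W.baseChange (ringClassField K ι m)).toAffine.Point}
    (hy : WeierstrassCurve.Affine.Point.map (W' := W) (ringClassField K ι m).subtype.toRatAlgHom y =
      heegnerPointComplexOfConductor Dt (NumberField.discr K) β m)
    (hle : ringClassField K ι m ≤ ringClassField K ι n)
    {θ : ℕ → ringClassField K ι n} {θ' : ℕ → ringClassField K ι m} {M : Finset ℕ}
    (hθ : ∀ ℓ ∈ M, θ ℓ ^ 2 = algebraMap ℚ (ringClassField K ι n) ((-1 : ℚ) ^ (ℓ / 2) * ℓ))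
    (hθ' : ∀ ℓ ∈ M, θ' ℓ ^ 2 = algebraMap ℚ (ringClassField K ι m) ((-1 : ℚ) ^ (ℓ / 2) * ℓ))
    (G : Finset (ringClassField K ι n ≃ₐ[ℚ] ringClassField K ι n)) (hG : ∀ g, g ∈ G ↔ g ∈ ringClassGal ι n)
    (Gm : Finset (ringClassField K ι m ≃ₐ[ℚ] ringClassField K ι m)) (hGm : ∀ s, s ∈ Gm ↔ s ∈ ringClassGal ι m)
    {c : ℕ} (hdeep : ∃ R : (W.baseChange (ringClassField K ι m)).toAffine.Point, ((2 : ℤ) ^ c) • R =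
      ∑ s ∈ Gm, (∏ ℓ ∈ M, (if s (θ' ℓ) = θ' ℓ then (1 : ℤ) else -1)) • pointGalHom W (ringClassField K ι m) s y) :
    ∃ Q : (W.baseChange (ringClassField K ι n)).toAffine.Point, ((2 : ℤ) ^ (c + t.primeFactors.card)) • Q =
      ∑ g ∈ G, (∏ ℓ ∈ M, (if g (θ ℓ) = θ ℓ then (1 : ℤ) else -1)) • pointGalHom W (ringClassField K ι n) g d.y := by
  -- `∏_{ℓ∣t} a_ℓ = 2^{#} · A′`
  have hA : ∃ A' : ℤ, (∏ ℓ ∈ t.primeFactors, W.frobeniusTrace ℓ) = (2 : ℤ) ^ t.primeFactors.card * A' := by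
    choose! b hb using heven
    refine ⟨∏ ℓ ∈ t.primeFactors, b ℓ, ?_⟩
    rw [Finset.prod_congr rfl (fun ℓ hℓ ↦ hb ℓ hℓ), Finset.prod_mul_distrib, Finset.prod_const]
  obtain ⟨A', hA'⟩ := hA
  obtain ⟨R, hR⟩ := hdeep
  refine ⟨A' • WeierstrassCurve.Affine.Point.map (W' := W) (Subfield.inclusion hle).toRatAlgHom R, ?_⟩
  rw [heegner_genusComponent_eq_prod_frobeniusTrace_smul_map hK hD hH hn hinert hN d hmt hy hle hθ hθ' G hG Gm hGm, ← hR, map_zsmul,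
    hA', smul_smul, smul_smul, pow_add]
  congr 1
  ring

/-- **THE (R1)-CHAIN, KERNEL-CHECKED: genus Heegner points deep at their own levels ⟹ `P(n) ∈ 2E(K[n])`.** For `W` globally
minimal with `ρ̄_{E,2}` onto, `K` imaginary quadratic with odd `d_K ≠ −3` and the Heegner hypothesis, `n` square-free of Kolyvagin primes
at `2`, a datum `d` of conductor `n`, radicals `θ` and an enumeration `G` of `𝒢_n`: IF for every `M ⊆ {ℓ ∣ n}` there is a level
`m` with `m·t = n`, an exponent `c` with `c + #{ℓ∣t} = r + 1`, a point `y ∈ E(K[m])` over `x(m)`, radicals `θ′` at level `m` and an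
enumeration `Gm` of `𝒢_m` such that the genus-character point `Y_M^{(m)} = Σ_{s∈Gm} χ_M(s) s·y` lies in `2^c E(K[m])` (the natural
choice: `m = ∏M` the conductor of `χ_M`, `c = #M + 1` — U-LEDGER (♣) predicts `ord₂ ≥ #M + 1` on `Δ_E > 0` with Gross primes, and
`M = ∅`, `m = 1`, `c = 1` is McCallum's `M₀ ≥ 1`), THEN `P(n) ∈ 2E(K[n])`: the level `n` certifies nothing.
[cite: GrossLMS1991, §3 (3.5), Prop. 3.7 (1), §4 (4.1), Lemma 4.3] [cite: McCallumLMS1991, §5] -/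
theorem heegner_exists_two_zsmul_eq_derivedPoint_of_forall_levels [W.IsElliptic] [W.IsGloballyMinimal]
    (hK : IsImaginaryQuadratic K) (hodd : Odd (NumberField.discr K)) (h3 : NumberField.discr K ≠ -3)
    (hH : SatisfiesHeegnerHypothesis (W.conductorNorm ℤ) K) (hsurj : W.HasSurjectiveModNGaloisRep ((2 : ℤ) ^ 1))
    {n : ℕ} (hn : Squarefree n) (hKoly : ∀ ℓ ∈ n.primeFactors, Zhang2014.IsKolyvaginPrime (W.conductorNorm ℤ) W K 2 ℓ)
    (d : KolyvaginHeegnerData Dt β ι n) {θ : ℕ → ringClassField K ι n}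
    (hθ : ∀ ℓ ∈ n.primeFactors, θ ℓ ^ 2 = algebraMap ℚ (ringClassField K ι n) ((-1 : ℚ) ^ (ℓ / 2) * ℓ))
    (G : Finset (ringClassField K ι n ≃ₐ[ℚ] ringClassField K ι n)) (hG : ∀ g, g ∈ G ↔ g ∈ ringClassGal ι n)
    (hlevels : ∀ M ∈ n.primeFactors.powerset, ∃ (m t c : ℕ), m * t = n ∧ c + t.primeFactors.card = n.primeFactors.card + 1 ∧
      ∃ (y : (W.baseChange (ringClassField K ι m)).toAffine.Point) (θ' : ℕ → ringClassField K ι m)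
        (Gm : Finset (ringClassField K ι m ≃ₐ[ℚ] ringClassField K ι m)),
        WeierstrassCurve.Affine.Point.map (W' := W) (ringClassField K ι m).subtype.toRatAlgHom y =
          heegnerPointComplexOfConductor Dt (NumberField.discr K) β m ∧
        (∀ ℓ ∈ M, θ' ℓ ^ 2 = algebraMap ℚ (ringClassField K ι m) ((-1 : ℚ) ^ (ℓ / 2) * ℓ)) ∧
        (∀ s, s ∈ Gm ↔ s ∈ ringClassGal ι m) ∧
        ∃ R : (W.baseChange (ringClassField K ι m)).toAffine.Point, ((2 : ℤ) ^ c) • R =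
          ∑ s ∈ Gm, (∏ ℓ ∈ M, (if s (θ' ℓ) = θ' ℓ then (1 : ℤ) else -1)) • pointGalHom W (ringClassField K ι m) s y) :
    ∃ Q : (W.baseChange (ringClassField K ι n)).toAffine.Point, (2 : ℤ) • Q = d.derivedPoint := by
  haveI : Fact (Nat.Prime 2) := ⟨Nat.prime_two⟩
  have hn0 : n ≠ 0 := hn.ne_zero
  have hD : NumberField.discr K < -4 := discr_lt_neg_four_of_odd hK hodd h3
  have hinert : ∀ q ∈ n.primeFactors, (Ideal.span {(q : 𝓞 K)}).IsPrime := fun q hq ↦ (hKoly q hq).2.2.2.2.1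
  have hN : ∀ q ∈ n.primeFactors, ¬ q ∣ W.conductorNorm ℤ := fun q hq ↦ (hKoly q hq).2.1
  refine heegner_exists_two_zsmul_eq_derivedPoint_of_forall_genusComponents hK hodd h3 hH hsurj hn hKoly d hθ G hG ?_
  intro M hM
  obtain ⟨m, t, c, hmt, hc, y, θ', Gm, hy, hθ', hGm, hdeep⟩ := hlevels M hM
  have htn : t ∣ n := Dvd.intro_left m hmt
  have hle : ringClassField K ι m ≤ ringClassField K ι n := ringClassField_mono hK ι (Dvd.intro t hmt) hn0
  have heven : ∀ ℓ ∈ t.primeFactors, (2 : ℤ) ∣ W.frobeniusTrace ℓ :=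
    fun ℓ hℓ ↦ (hKoly ℓ (Nat.primeFactors_mono htn hn0 hℓ)).dvd.2
  have h := heegner_exists_pow_smul_eq_genusComponent_of_level hK hD hH hn hinert hN d hmt heven hy hle
    (fun ℓ hℓ ↦ hθ ℓ (Finset.mem_powerset.mp hM hℓ)) hθ' G hG Gm hGm hdeep
  rwa [hc] at h

end Heegner

end Summit.BirchSwinnertonDyer.BirchSwinnertonDyer.Theorems.GenusKoly

end
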